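/-
Copyright (c) 2026 the pub-hodgecm-mathlib formalisation cell (harness21).  Prover seat hodgecm-mathlib-A-p03 (g24); LEAD F0P3a-plan (g9) WORD T8-81 «LAYER B_H»;
type-(2) VALUE closed over B-p04 (g33)'s `UnitaryThreeFixedPointsCountRamified` and B-p12 (g28)'s γ2′ files, 2026-09-01.
-/
import Literature.NumberTheory.Rogawski1990.UnitOrbitalIntegralInertValueTH
import Literature.NumberTheory.Rogawski1990.UnitOrbitalIntegralInertValueThetaOneClosed      -- ★ `subgroupOf_flickerHK_eq`
import Literature.NumberTheory.Automorphic.UnitaryThreeFixedPointsCountRamified               -- ★ B-p04 (F3c-C9-θ′)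
import HarnessLib

/-!
# LAYER C, `T_H` clause, closed form: `#{q ∈ U⧸K : t′ q = q} = phiTHM q N₊ N` with the type-(2) Cor. 9 supplied by ★ `natCard_fixedPoints_ramifiedTorus_eq_finsum`

Topic `NumberTheory/Rogawski1990` (road «D-N7-inert», MAP v3 (F11) κ = +1 value); namespace `Literature.NumberTheory.Automorphic.UnitaryGroup`.  THEOREMS ONLY;
kernel lane.

★ `natCard_fixedPoints_unitaryInt_ramifiedTorus_eq_phiTHM` (p841800) took the type-(2) Cor. 9 as `hC9`; B-p04's ★ `natCard_fixedPoints_ramifiedTorus_eq_finsum` proves it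
per `m` (in the `(flickerHK c u_m).subgroupOf H` currency, over B-p12's γ2′ `hA′`∕`hB′` and the weight `hweight : relIndex = q^n`, with the one K-side binder
`hMars`).  This file discharges `hC9`: **`natCard_fixedPoints_unitaryInt_ramifiedTorus_eq_phiTHM_of_bridge`** — the κ = +1 (`T_H`) VALUE with only frame ∕ bridge ∕
`hMars` ∕ `hweight` data as hypotheses.
HONEST LABEL: HC_CM is proved only modulo the printed citations until rung 0 closes.

## References
* [Flicker1998UnitaryFL] Y. Z. Flicker, *Elementary proof of the fundamental lemma for a unitary group*, Canad. J. Math. 50 (1998), 74–98: Prop. 5 p. 82, Prop. 6 p. 83,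
  Cor. 9 p. 85, Prop. 10 p. 85, Prop. 11 p. 87.
* [Rogawski1990] J. D. Rogawski, *Automorphic Representations of Unitary Groups in Three Variables* (1990), §4.9 p. 55.
-/

set_option autoImplicit false

open scoped MatrixGroups WithZero Valued
open Matrix

universe u

namespace Literature.NumberTheory.Automorphic

namespace UnitaryGroup

open Literature.NumberTheory.Automorphic.HermitianLattice (unitaryInt mem_unitaryInt_iff LocalConjDatum)
open Literature.NumberTheory.Rogawski1990.Flicker1998 (iTen phiTHM)
open IsLocalRing

variable {K : Type*} [Field K] [Valued K ℤᵐ⁰] {ϖ : K} (σ : K →+* K) {J : Matrix (Fin 3) (Fin 3) K}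

section THClosed

variable [IsDiscreteValuationRing 𝒪[K]] [Finite (ResidueField 𝒪[K])] [IsAdicComplete (maximalIdeal 𝒪[K]) 𝒪[K]]

set_option synthInstance.maxHeartbeats 200000 in
-- the `H`-action on `H ⧸ (K^{u_m} ∩ H)` is found through the large subgroup terms of the `U(2,1)` frame (as in ★ (F2))
/-- **LAYER C, `T_H` clause, CLOSED**: `#{q ∈ U⧸K : t′ q = q} = phiTHM q N₊ N` for B-p12's ramified-torus literal `t′`, the type-(2) Cor. 9 supplied by ★
B-p04's `natCard_fixedPoints_ramifiedTorus_eq_finsum` over the lattice bridge `(R, ι, σR, dR)`, B-p12's `hMars` and weight `hweight : relIndex = q^n`.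
[cite: Flicker1998UnitaryFL, Prop. 5 p. 82, Prop. 6 p. 83, Cor. 9 p. 85, Prop. 10 p. 85, Prop. 11 p. 87] -/
theorem natCard_fixedPoints_unitaryInt_ramifiedTorus_eq_phiTHM_of_bridge (hJ : J = (StdForm.antidiagonal 3).over K) (hd : LocalConjDatum σ ϖ)
    (hσO : ∀ y : 𝒪[K], (σ.comp 𝒪[K].subtype) y ∈ 𝒪[K]) {y : K} (hy : y * σ y = -2)
    {c : ↥(unitaryGroupOfForm σ J)} (hc : ((c : GL (Fin 3) K) : Matrix (Fin 3) (Fin 3) K) = !![1, 0, 0; 0, -1, 0; 0, 0, 1])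
    (u : ℕ → ↥(unitaryGroupOfForm σ J))
    (hu : ∀ m, ((u m : GL (Fin 3) K) : Matrix (Fin 3) (Fin 3) K) = !![ϖ ^ m, y, (ϖ ^ m)⁻¹; 0, 1, -σ y * (ϖ ^ m)⁻¹; 0, 0, (ϖ ^ m)⁻¹])
    {R : Type u} [CommRing R] [IsDomain R] [IsDiscreteValuationRing R] [IsAdicComplete (IsLocalRing.maximalIdeal R) R]
    (ι : R →+* K) (hι : Function.Injective ι)
    (hιv : ∀ x : K, Valued.v x ≤ 1 ↔ x ∈ Set.range ι) (σR : R →+* R) (hσR : ∀ r, σR (σR r) = r) (hσι : ∀ r, ι (σR r) = σ (ι r))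
    {dR : R} (hdRσ : σR dR = -dR) (hdRu : IsUnit dR) (h2R : IsUnit (2 : R))
    {ρ π₀ : K} (hvρ : Valued.v ρ = Valued.v ϖ) (hσρ : σ ρ = ρ) (hπ₀ : π₀ = ι dR ^ 2 * ρ)
    (hMars : ∀ G : Matrix (Fin 2) (Fin 2) K, (∀ a b, σ (G a b) = G a b) → (∀ a b, Valued.v (G a b) ≤ 1) →
      G 0 0 * G 1 1 - G 0 1 * G 1 0 ≠ 0 →
      ∃ (u v : K) (i : ℕ) (U₀ U₁ W₀ W₁ : K), σ u = u ∧ σ v = v ∧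
        Valued.v U₀ ≤ 1 ∧ Valued.v U₁ ≤ 1 ∧ Valued.v W₀ ≤ 1 ∧ Valued.v W₁ ≤ 1 ∧ Valued.v (U₀ * W₁ - U₁ * W₀) = 1 ∧
        G 0 0 = u * U₀ + π₀ * v * (π₀ ^ i * W₀) ∧ G 1 0 = v * U₀ + u * (π₀ ^ i * W₀) ∧
        G 0 1 = u * U₁ + π₀ * v * (π₀ ^ i * W₁) ∧ G 1 1 = v * U₁ + u * (π₀ ^ i * W₁))
    {t : ↥(unitaryGroupOfForm σ J)} {A B C b₀ : K} (hte : ((t : GL (Fin 3) K) : Matrix (Fin 3) (Fin 3) K) = !![A, 0, B; 0, b₀, 0; C, 0, A])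
    (htH : t ∈ Subgroup.centralizer ({c} : Set ↥(unitaryGroupOfForm σ J))) (hBC : B = C * ρ)
    (r : ℕ → ↥(Subgroup.centralizer ({c} : Set ↥(unitaryGroupOfForm σ J))))
    (hr0 : ∀ a : ℕ, (((r (2 * a) : ↥(unitaryGroupOfForm σ J)) : GL (Fin 3) K) : Matrix (Fin 3) (Fin 3) K) = !![(ϖ ^ a)⁻¹, 0, 0; 0, 1, 0; 0, 0, ϖ ^ a])
    (hr1 : ∀ a : ℕ, (((r (2 * a + 1) : ↥(unitaryGroupOfForm σ J)) : GL (Fin 3) K) : Matrix (Fin 3) (Fin 3) K) =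
      !![0, 0, ϖ ^ (a + 1) / ι dR; 0, 1, 0; -ι dR * (ϖ ^ (a + 1))⁻¹, 0, 0])
    {N Np : ℕ} (hvC : Valued.v C = Valued.v (ϖ ^ N)) (hs : Valued.v (A - b₀) = Valued.v (ϖ ^ Np))
    {q : ℕ} (hq : Nat.card (ResidueField 𝒪[K]) = q ^ 2) (hq1 : 1 < q)
    (hweight : ∀ n : ℕ, ((((flickerKH σ J c).subgroupOf (Subgroup.centralizer ({c} : Set ↥(unitaryGroupOfForm σ J)))).map
        (MulAut.conj (r n)).toMonoidHom).relIndex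
        (Subgroup.centralizer ({⟨t, htH⟩} : Set ↥(Subgroup.centralizer ({c} : Set ↥(unitaryGroupOfForm σ J)))))) = q ^ n)
    {a₀ : 𝒪[K]} (ha₀ : IsUnit (((σ.comp 𝒪[K].subtype).codRestrict 𝒪[K] hσO) a₀ - a₀))
    (hfin : {x : ↥(unitaryGroupOfForm σ J) ⧸ unitaryInt σ J | t • x = x}.Finite) :
    (Nat.card {x : ↥(unitaryGroupOfForm σ J) ⧸ unitaryInt σ J | t • x = x} : ℚ) = phiTHM q Np N := by
  have hϖ0 : ϖ ≠ 0 := hd.ϖ_ne_zero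
  have hvd : Valued.v (ι dR) = 1 := v_map_eq_one_of_isUnit ι hιv hdRu
  have hσd : σ (ι dR) = -(ι dR) := by rw [← hσι, hdRσ, map_neg]
  have hC : C ≠ 0 := fun h => by rw [h, map_zero] at hvC; exact (pow_ne_zero _ hϖ0) ((map_eq_zero _).1 hvC.symm)
  refine natCard_fixedPoints_unitaryInt_ramifiedTorus_eq_phiTHM σ hJ hd hσO hy hc u hu hte htH hBC hvρ hσρ hvd hσd r hr0 hr1 hvC hs hq hq1 ha₀
    hfin fun m => ?_
  have hS := subgroupOf_flickerHK_eq σ c (u m)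
  have hfinm : {x : ↥(Subgroup.centralizer ({c} : Set ↥(unitaryGroupOfForm σ J))) ⧸
      (flickerHK σ J c (u m)).subgroupOf (Subgroup.centralizer ({c} : Set ↥(unitaryGroupOfForm σ J))) |
        (⟨t, htH⟩ : ↥(Subgroup.centralizer ({c} : Set ↥(unitaryGroupOfForm σ J)))) • x = x}.Finite := by
    rw [hS]; exact Set.finite_coe_iff.1 ((finite_setOf_nonempty_fixedPoints_flickerU σ hJ hd hy hc u hu htH hfin).2 m)
  have h9 := natCard_fixedPoints_ramifiedTorus_eq_finsum σ hJ hd hy m (hu m) ι hι hιv σR hσR hσι hdRσ hdRu h2R hc hvρ hπ₀ hMars htH hte hC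
    hBC r hr0 hr1 hweight hfinm
  rw [hS] at h9
  exact h9

end THClosed

end UnitaryGroup

end Literature.NumberTheory.Automorphic
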